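import Mathlib
import Summits.CriticalPhenomena.PercolationContinuityZ3.Theorems.PercNearOneGluingNoHeavyLowerTailOrientedAntipodalHallCyclicMS
import Summits.CriticalPhenomena.PercolationContinuityZ3.Theorems.PercNearOneGluingNoHeavyLowerTailOrientedAntipodalHallChainMS

/-!
# Cyclic selections: the Hall count from the SYMMETRIC three-family inequality `MS3-sym`

Helper file for crux `stmt-CriticalPhenomena-4575` (`NoHeavyLowerTail`, route `PercNearOneGluingNoHeavy`),
new-inequality factory seat `prim-ineq-gen-3` (gen 7).  Everything here is PROVED; the open combinatorial
inequality enters as a HYPOTHESIS, but now in its cleanest abstract form.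

`OrientedAntipodalHall.card_le_card_goods_above_cyclic` (gen 5) reduces the capacity-one Hall count for a
cyclic orientation selection `(i,j), (j,l), (l,i)` to an instance-specific inequality `hMS3` on the three
families of bads (blocks `D_t \\ D_t`, `S \ (X ∪ Y)`, witnessed `Y \ X`).  This file replaces `hMS3` by the
abstract, fully `S₃`-symmetric statement `MS3-sym` of the memo (COMB.md §3c (xix)–(xx), MS3-STATE.md §3):

> for three families `P, Q, R` of subsets of `S` which are pairwise intersecting, pairwise
> co-intersecting in `S` (`U ∪ U' ≠ S`) and cross-incomparable (the hypotheses `LAB=1` that the labels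
> supply), `#P + #Q + #R ≤ #K_sym`, where `K_sym` consists of the within-family differences `P \\ P, …`,
> the cross meets `P ⊼ Q, …`, and the *collapse differences* `U \ V` for `U ∈ P`, `V ∈ Q`, `W ∈ R` with
> `U ∩ V = U ∩ W` (and cyclically).

`card_le_card_goods_above_cyclic_of_sym` applies this to the COMPLEMENT families `P = {S \ X : X ∈ D₁}`, …:
their `K_sym` lies inside the block family of `hMS3` (complement differences are reversed differences,
complement meets are `S \ (X ∪ Y)`, and a collapse `(S \ X) \ (S \ Y) = Y \ X` with
`S \ (X ∪ Y) = S \ (X ∪ Z)` is witnessed by `Z ⊇ Y \ X`), and the `LAB=1` hypotheses follow from the labels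
(`compl_inter_compl_nonempty`, `compl_union_compl_ne`, `not_compl_subset_compl`: two bads whose types are
not opposite have intersecting, co-intersecting complements; bads of types with different first petal are
incomparable).  So a proof of `MS3-sym` — for which an exhaustive census (n ≤ 6) finds per-member triangular
Möbius certificates in every instance (conjecture `CERT-T`, engine `IntervalCertificate.card_le_card_of_certificate`)
— discharges the cyclic Hall count with no further plumbing.
(prim-ineq-gen-3 gen 7, 2026-08-20; memo `run/shared/lean/prim/prim-ineq-gen-3/MS3-STATE.md`.)
-/

namespace Summit.CriticalPhenomena.PercolationContinuityZ3.Theorems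

namespace OrientedAntipodalHall

open Finset AntipodalStrongHarris AntipodalStrongHarris.Lab
open scoped FinsetFamily

variable {α : Type*} [DecidableEq α] {k : ℕ}

/-- Complements of two bads `X` (type `(a,b)`) and `Y` (type `(c,d)`) intersect inside `S` unless the types
are opposite (`b = c` and `d = a`): an empty intersection gives `S \ X ⊆ Y` and `S \ Y ⊆ X`. -/
theorem compl_inter_compl_nonempty (S : Finset α) {f : Finset α → Lab k}
    (hf : ∀ ⦃X Y : Finset α⦄, X ⊆ Y → f X ≤ f Y) {X Y : Finset α} {a b c d : Fin k}
    (hX : f X = petal a) (hSX : f (S \ X) = petal b) (hY : f Y = petal c) (hSY : f (S \ Y) = petal d)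
    (h : ¬ (b = c ∧ d = a)) : ((S \ X) ∩ (S \ Y)).Nonempty := by
  rw [nonempty_iff_ne_empty]
  intro he
  apply h
  constructor
  · have hsub : S \ X ⊆ Y := by
      intro x hx
      by_contra hxY
      have hx' : x ∈ (S \ X) ∩ (S \ Y) := mem_inter.mpr ⟨hx, mem_sdiff.mpr ⟨(mem_sdiff.mp hx).1, hxY⟩⟩
      rw [he] at hx'
      simp at hx'
    exact eq_of_petal_le_petal (by rw [← hSX, ← hY]; exact hf hsub)
  · have hsub : S \ Y ⊆ X := by
      intro x hx
      by_contra hxX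
      have hx' : x ∈ (S \ X) ∩ (S \ Y) := mem_inter.mpr ⟨mem_sdiff.mpr ⟨(mem_sdiff.mp hx).1, hxX⟩, hx⟩
      rw [he] at hx'
      simp at hx'
    exact eq_of_petal_le_petal (by rw [← hSY, ← hX]; exact hf hsub)

/-- Complements of two bads `X ⊆ S` (type `(a,b)`) and `Y ⊆ S` (type `(c,d)`) do not cover `S` unless the
types are opposite (`a = d` and `c = b`): `(S \ X) ∪ (S \ Y) = S` forces `X ∩ Y = ∅`, i.e. `X ⊆ S \ Y` and
`Y ⊆ S \ X`. -/
theorem compl_union_compl_ne (S : Finset α) {f : Finset α → Lab k}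
    (hf : ∀ ⦃X Y : Finset α⦄, X ⊆ Y → f X ≤ f Y) {X Y : Finset α} (hXS : X ⊆ S) (hYS : Y ⊆ S)
    {a b c d : Fin k} (hX : f X = petal a) (hSX : f (S \ X) = petal b) (hY : f Y = petal c)
    (hSY : f (S \ Y) = petal d) (h : ¬ (a = d ∧ c = b)) : (S \ X) ∪ (S \ Y) ≠ S := by
  intro he
  have hdisj : ∀ x, x ∈ X → x ∉ Y := by
    intro x hxX hxY
    have hxU : x ∈ (S \ X) ∪ (S \ Y) := by rw [he]; exact hXS hxX
    rcases mem_union.mp hxU with h1 | h1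
    · exact (mem_sdiff.mp h1).2 hxX
    · exact (mem_sdiff.mp h1).2 hxY
  apply h
  constructor
  · have hsub : X ⊆ S \ Y := fun x hx => mem_sdiff.mpr ⟨hXS hx, hdisj x hx⟩
    exact eq_of_petal_le_petal (by rw [← hX, ← hSY]; exact hf hsub)
  · have hsub : Y ⊆ S \ X := fun y hy => mem_sdiff.mpr ⟨hYS hy, fun hyX => hdisj y hyX hy⟩
    exact eq_of_petal_le_petal (by rw [← hY, ← hSX]; exact hf hsub)

/-- Complements of bads with different first petals are incomparable: `S \ X ⊆ S \ Y` with `Y ⊆ S` gives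
`Y ⊆ X`, hence `C_c ≤ C_a`. -/
theorem not_compl_subset_compl (S : Finset α) {f : Finset α → Lab k}
    (hf : ∀ ⦃X Y : Finset α⦄, X ⊆ Y → f X ≤ f Y) {X Y : Finset α} (hYS : Y ⊆ S) {a c : Fin k}
    (hX : f X = petal a) (hY : f Y = petal c) (hac : a ≠ c) : ¬ S \ X ⊆ S \ Y := by
  intro hsub
  have hYX : Y ⊆ X := by
    intro y hy
    by_contra hyX
    have hy' : y ∈ S \ Y := hsub (mem_sdiff.mpr ⟨hYS hy, hyX⟩)
    exact (mem_sdiff.mp hy').2 hy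
  exact hac (eq_of_petal_le_petal (by rw [← hY, ← hX]; exact hf hYX)).symm

/-- Set algebra inside `S`: `(S \ X) \ (S \ Y) = Y \ X` for `Y ⊆ S`. -/
theorem sdiff_sdiff_sdiff_eq_sdiff (S : Finset α) {X Y : Finset α} (hYS : Y ⊆ S) :
    (S \ X) \ (S \ Y) = Y \ X := by
  ext x
  simp only [mem_sdiff, not_and, not_not]
  constructor
  · rintro ⟨⟨hxS, hxX⟩, h⟩
    exact ⟨h hxS, hxX⟩
  · rintro ⟨hxY, hxX⟩
    exact ⟨⟨hYS hxY, hxX⟩, fun _ => hxY⟩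

/-- Set algebra inside `S`: `(S \ X) ∩ (S \ Y) = S \ (X ∪ Y)`. -/
theorem sdiff_inter_sdiff_eq_sdiff_union (S X Y : Finset α) : (S \ X) ∩ (S \ Y) = S \ (X ∪ Y) := by
  ext x
  simp only [mem_inter, mem_sdiff, mem_union, not_or]
  constructor
  · rintro ⟨⟨hxS, hxX⟩, -, hxY⟩
    exact ⟨hxS, hxX, hxY⟩
  · rintro ⟨hxS, hxX, hxY⟩
    exact ⟨⟨hxS, hxX⟩, hxS, hxY⟩

/-- If `S \ (X ∪ Y) = S \ (X ∪ Z)` with `Y ⊆ S`, then `Y \ X ⊆ Z`. -/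
theorem sdiff_subset_of_sdiff_union_eq (S : Finset α) {X Y Z : Finset α} (hYS : Y ⊆ S)
    (h : S \ (X ∪ Y) = S \ (X ∪ Z)) : Y \ X ⊆ Z := by
  intro y hy
  obtain ⟨hyY, hyX⟩ := mem_sdiff.mp hy
  by_contra hyZ
  have hmem : y ∈ S \ (X ∪ Z) := mem_sdiff.mpr ⟨hYS hyY, fun h' => by
    rcases mem_union.mp h' with h'' | h''
    · exact hyX h''
    · exact hyZ h''⟩
  rw [← h] at hmem
  exact (mem_sdiff.mp hmem).2 (mem_union_right _ hyY)

/-- **Cyclic selections: Hall count from the symmetric three-family inequality `MS3-sym`.**  Let `f` be a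
sunflower labeling and `D₁, D₂, D₃` families of antipodal bads inside `S` of the cyclic types `(i,j)`, `(j,l)`,
`(l,i)` (`i, j, l` distinct).  Assume `MS3-sym` for three families of subsets of `S` under the `LAB=1` hypotheses
(all pairs intersecting and co-intersecting in `S`, cross pairs incomparable): `#P + #Q + #R ≤ #K_sym(P,Q,R)`,
`K_sym` = within-family differences ∪ cross meets ∪ collapse differences.  Then at least `#D₁ + #D₂ + #D₃` good
sets `U ⊆ S` contain a member of `D₁ ∪ D₂ ∪ D₃`.  (Applied to the complement families; their `K_sym` lies in the
block family of `card_le_card_goods_above_cyclic`.) -/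
theorem card_le_card_goods_above_cyclic_of_sym (S : Finset α) {f : Finset α → Lab k}
    (hf : ∀ ⦃X Y : Finset α⦄, X ⊆ Y → f X ≤ f Y) (D₁ D₂ D₃ : Finset (Finset α)) {i j l : Fin k}
    (hij : i ≠ j) (hjl : j ≠ l) (hil : i ≠ l)
    (h₁S : ∀ X ∈ D₁, X ⊆ S) (h₁i : ∀ X ∈ D₁, f X = petal i) (h₁j : ∀ X ∈ D₁, f (S \ X) = petal j)
    (h₂S : ∀ X ∈ D₂, X ⊆ S) (h₂j : ∀ X ∈ D₂, f X = petal j) (h₂l : ∀ X ∈ D₂, f (S \ X) = petal l)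
    (h₃S : ∀ X ∈ D₃, X ⊆ S) (h₃l : ∀ X ∈ D₃, f X = petal l) (h₃i : ∀ X ∈ D₃, f (S \ X) = petal i)
    (hMS3sym : ∀ P Q R : Finset (Finset α),
      (∀ U ∈ P ∪ Q ∪ R, U ⊆ S) →
      (∀ U ∈ P ∪ Q ∪ R, ∀ U' ∈ P ∪ Q ∪ R, (U ∩ U').Nonempty) →
      (∀ U ∈ P ∪ Q ∪ R, ∀ U' ∈ P ∪ Q ∪ R, U ∪ U' ≠ S) →
      (∀ U ∈ P, ∀ U' ∈ Q, ¬ U ⊆ U' ∧ ¬ U' ⊆ U) →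
      (∀ U ∈ Q, ∀ U' ∈ R, ¬ U ⊆ U' ∧ ¬ U' ⊆ U) →
      (∀ U ∈ R, ∀ U' ∈ P, ¬ U ⊆ U' ∧ ¬ U' ⊆ U) →
      #P + #Q + #R ≤
        #((P \\ P ∪ Q \\ Q ∪ R \\ R) ∪ (P ⊼ Q ∪ Q ⊼ R ∪ R ⊼ P) ∪
          ((((P ×ˢ (Q ×ˢ R)).filter fun p => p.1 ∩ p.2.1 = p.1 ∩ p.2.2).image fun p => p.1 \ p.2.1) ∪
           (((Q ×ˢ (R ×ˢ P)).filter fun p => p.1 ∩ p.2.1 = p.1 ∩ p.2.2).image fun p => p.1 \ p.2.1) ∪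
           (((R ×ˢ (P ×ˢ Q)).filter fun p => p.1 ∩ p.2.1 = p.1 ∩ p.2.2).image fun p => p.1 \ p.2.1)))) :
    #D₁ + #D₂ + #D₃ ≤
      #{U ∈ S.powerset | f U = top ∧ f (S \ U) = bot ∧ ∃ X ∈ D₁ ∪ D₂ ∪ D₃, X ⊆ U} := by
  classical
  -- the complement families
  set P : Finset (Finset α) := D₁.image (S \ ·) with hPdef
  set Q : Finset (Finset α) := D₂.image (S \ ·) with hQdef
  set R : Finset (Finset α) := D₃.image (S \ ·) with hRdef
  -- complementation is injective on subsets of `S`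
  have hinj : ∀ D : Finset (Finset α), (∀ X ∈ D, X ⊆ S) → #(D.image (S \ ·)) = #D := by
    intro D hD
    apply card_image_of_injOn
    intro X hX Y hY hXY
    have e₁ := Finset.sdiff_sdiff_eq_self (hD X hX)
    have e₂ := Finset.sdiff_sdiff_eq_self (hD Y hY)
    simp only at hXY
    rw [← e₁, ← e₂, hXY]
  have hcP : #P = #D₁ := by rw [hPdef]; exact hinj D₁ h₁S
  have hcQ : #Q = #D₂ := by rw [hQdef]; exact hinj D₂ h₂S
  have hcR : #R = #D₃ := by rw [hRdef]; exact hinj D₃ h₃S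
  -- every member of `P ∪ Q ∪ R` is the complement of a typed bad; types encoded by `s : Fin 3`
  have typed : ∀ U ∈ P ∪ Q ∪ R, ∃ X : Finset α, X ⊆ S ∧ U = S \ X ∧ ∃ s : Fin 3,
      f X = petal (![i, j, l] s) ∧ f (S \ X) = petal (![j, l, i] s) := by
    intro U hU
    rcases mem_union.mp hU with hU | hU
    · rcases mem_union.mp hU with hU | hU
      · obtain ⟨X, hX, rfl⟩ := mem_image.mp hU
        exact ⟨X, h₁S X hX, rfl, 0, by simpa using h₁i X hX, by simpa using h₁j X hX⟩
      · obtain ⟨X, hX, rfl⟩ := mem_image.mp hU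
        exact ⟨X, h₂S X hX, rfl, 1, by simpa using h₂j X hX, by simpa using h₂l X hX⟩
    · obtain ⟨X, hX, rfl⟩ := mem_image.mp hU
      exact ⟨X, h₃S X hX, rfl, 2, by simpa using h₃l X hX, by simpa using h₃i X hX⟩
  -- no two cyclic types are opposite
  have hnotopp : ∀ s t : Fin 3, ¬ (![j, l, i] s = ![i, j, l] t ∧ ![j, l, i] t = ![i, j, l] s) := by
    intro s t
    fin_cases s <;> fin_cases t <;> simp [hij, hjl, hil, hij.symm, hjl.symm, hil.symm]
  have hnotopp' : ∀ s t : Fin 3, ¬ (![i, j, l] s = ![j, l, i] t ∧ ![i, j, l] t = ![j, l, i] s) := by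
    intro s t h
    exact hnotopp t s ⟨h.1.symm, h.2.symm⟩
  -- the `LAB=1` hypotheses for the complement families
  have hsub : ∀ U ∈ P ∪ Q ∪ R, U ⊆ S := by
    intro U hU
    obtain ⟨X, -, rfl, -⟩ := typed U hU
    exact sdiff_subset
  have hint : ∀ U ∈ P ∪ Q ∪ R, ∀ U' ∈ P ∪ Q ∪ R, (U ∩ U').Nonempty := by
    intro U hU U' hU'
    obtain ⟨X, -, rfl, s, hX, hSX⟩ := typed U hU
    obtain ⟨Y, -, rfl, t, hY, hSY⟩ := typed U' hU'
    exact compl_inter_compl_nonempty S hf hX hSX hY hSY (hnotopp s t)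
  have hcoint : ∀ U ∈ P ∪ Q ∪ R, ∀ U' ∈ P ∪ Q ∪ R, U ∪ U' ≠ S := by
    intro U hU U' hU'
    obtain ⟨X, hXS, rfl, s, hX, hSX⟩ := typed U hU
    obtain ⟨Y, hYS, rfl, t, hY, hSY⟩ := typed U' hU'
    exact compl_union_compl_ne S hf hXS hYS hX hSX hY hSY (hnotopp' s t)
  have hPQ : ∀ U ∈ P, ∀ U' ∈ Q, ¬ U ⊆ U' ∧ ¬ U' ⊆ U := by
    intro U hU U' hU'
    obtain ⟨X, hX, rfl⟩ := mem_image.mp hU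
    obtain ⟨Y, hY, rfl⟩ := mem_image.mp hU'
    exact ⟨not_compl_subset_compl S hf (h₂S Y hY) (h₁i X hX) (h₂j Y hY) hij,
      not_compl_subset_compl S hf (h₁S X hX) (h₂j Y hY) (h₁i X hX) hij.symm⟩
  have hQR : ∀ U ∈ Q, ∀ U' ∈ R, ¬ U ⊆ U' ∧ ¬ U' ⊆ U := by
    intro U hU U' hU'
    obtain ⟨Y, hY, rfl⟩ := mem_image.mp hU
    obtain ⟨Z, hZ, rfl⟩ := mem_image.mp hU'
    exact ⟨not_compl_subset_compl S hf (h₃S Z hZ) (h₂j Y hY) (h₃l Z hZ) hjl,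
      not_compl_subset_compl S hf (h₂S Y hY) (h₃l Z hZ) (h₂j Y hY) hjl.symm⟩
  have hRP : ∀ U ∈ R, ∀ U' ∈ P, ¬ U ⊆ U' ∧ ¬ U' ⊆ U := by
    intro U hU U' hU'
    obtain ⟨Z, hZ, rfl⟩ := mem_image.mp hU
    obtain ⟨X, hX, rfl⟩ := mem_image.mp hU'
    exact ⟨not_compl_subset_compl S hf (h₁S X hX) (h₃l Z hZ) (h₁i X hX) hil.symm,
      not_compl_subset_compl S hf (h₃S Z hZ) (h₁i X hX) (h₃l Z hZ) hil⟩
  have hPQR := hMS3sym P Q R hsub hint hcoint hPQ hQR hRP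
  -- `K_sym` of the complement families lies in the block family of `hMS3`
  have hKsub :
      (P \\ P ∪ Q \\ Q ∪ R \\ R) ∪ (P ⊼ Q ∪ Q ⊼ R ∪ R ⊼ P) ∪
          ((((P ×ˢ (Q ×ˢ R)).filter fun p => p.1 ∩ p.2.1 = p.1 ∩ p.2.2).image fun p => p.1 \ p.2.1) ∪
           (((Q ×ˢ (R ×ˢ P)).filter fun p => p.1 ∩ p.2.1 = p.1 ∩ p.2.2).image fun p => p.1 \ p.2.1) ∪
           (((R ×ˢ (P ×ˢ Q)).filter fun p => p.1 ∩ p.2.1 = p.1 ∩ p.2.2).image fun p => p.1 \ p.2.1)) ⊆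
      ((D₁ \\ D₁) ∪ ((D₁ ×ˢ D₂).image fun p => S \ (p.1 ∪ p.2)) ∪
        (((D₁ ×ˢ D₂).filter fun p => ∃ Z ∈ D₃, p.2 \ p.1 ⊆ Z).image fun p => p.2 \ p.1)) ∪
        ((D₂ \\ D₂) ∪ ((D₂ ×ˢ D₃).image fun p => S \ (p.1 ∪ p.2)) ∪
        (((D₂ ×ˢ D₃).filter fun p => ∃ Z ∈ D₁, p.2 \ p.1 ⊆ Z).image fun p => p.2 \ p.1)) ∪
        ((D₃ \\ D₃) ∪ ((D₃ ×ˢ D₁).image fun p => S \ (p.1 ∪ p.2)) ∪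
        (((D₃ ×ˢ D₁).filter fun p => ∃ Z ∈ D₂, p.2 \ p.1 ⊆ Z).image fun p => p.2 \ p.1)) := by
    intro T hT
    simp only [mem_union] at hT ⊢
    rcases hT with (((hT | hT) | hT) | ((hT | hT) | hT)) | ((hT | hT) | hT)
    · -- P \\ P : (S \ X) \ (S \ X') = X' \ X
      obtain ⟨U, hU, U', hU', rfl⟩ := mem_diffs.mp hT
      obtain ⟨X, hX, rfl⟩ := mem_image.mp hU
      obtain ⟨X', hX', rfl⟩ := mem_image.mp hU'
      rw [sdiff_sdiff_sdiff_eq_sdiff S (h₁S X' hX')]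
      exact Or.inl (Or.inl (Or.inl (Or.inl (sdiff_mem_diffs hX' hX))))
    · -- Q \\ Q
      obtain ⟨U, hU, U', hU', rfl⟩ := mem_diffs.mp hT
      obtain ⟨Y, hY, rfl⟩ := mem_image.mp hU
      obtain ⟨Y', hY', rfl⟩ := mem_image.mp hU'
      rw [sdiff_sdiff_sdiff_eq_sdiff S (h₂S Y' hY')]
      exact Or.inl (Or.inr (Or.inl (Or.inl (sdiff_mem_diffs hY' hY))))
    · -- R \\ R
      obtain ⟨U, hU, U', hU', rfl⟩ := mem_diffs.mp hT
      obtain ⟨Z, hZ, rfl⟩ := mem_image.mp hU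
      obtain ⟨Z', hZ', rfl⟩ := mem_image.mp hU'
      rw [sdiff_sdiff_sdiff_eq_sdiff S (h₃S Z' hZ')]
      exact Or.inr (Or.inl (Or.inl (sdiff_mem_diffs hZ' hZ)))
    · -- P ⊼ Q : (S \ X) ∩ (S \ Y) = S \ (X ∪ Y)
      obtain ⟨U, hU, U', hU', rfl⟩ := mem_infs.mp hT
      obtain ⟨X, hX, rfl⟩ := mem_image.mp hU
      obtain ⟨Y, hY, rfl⟩ := mem_image.mp hU'
      refine Or.inl (Or.inl (Or.inl (Or.inr ?_)))
      rw [inf_eq_inter, sdiff_inter_sdiff_eq_sdiff_union]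
      exact mem_image.mpr ⟨(X, Y), mem_product.mpr ⟨hX, hY⟩, rfl⟩
    · -- Q ⊼ R
      obtain ⟨U, hU, U', hU', rfl⟩ := mem_infs.mp hT
      obtain ⟨Y, hY, rfl⟩ := mem_image.mp hU
      obtain ⟨Z, hZ, rfl⟩ := mem_image.mp hU'
      refine Or.inl (Or.inr (Or.inl (Or.inr ?_)))
      rw [inf_eq_inter, sdiff_inter_sdiff_eq_sdiff_union]
      exact mem_image.mpr ⟨(Y, Z), mem_product.mpr ⟨hY, hZ⟩, rfl⟩
    · -- R ⊼ P
      obtain ⟨U, hU, U', hU', rfl⟩ := mem_infs.mp hT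
      obtain ⟨Z, hZ, rfl⟩ := mem_image.mp hU
      obtain ⟨X, hX, rfl⟩ := mem_image.mp hU'
      refine Or.inr (Or.inl (Or.inr ?_))
      rw [inf_eq_inter, sdiff_inter_sdiff_eq_sdiff_union]
      exact mem_image.mpr ⟨(Z, X), mem_product.mpr ⟨hZ, hX⟩, rfl⟩
    · -- collapse of a `P`-member: (S \ X) \ (S \ Y) = Y \ X, witnessed by `Z ⊇ Y \ X`
      obtain ⟨⟨U, V, W'⟩, hp, rfl⟩ := mem_image.mp hT
      simp only [mem_filter, mem_product] at hp
      obtain ⟨⟨hU, hV, hW'⟩, heq⟩ := hp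
      obtain ⟨X, hX, rfl⟩ := mem_image.mp hU
      obtain ⟨Y, hY, rfl⟩ := mem_image.mp hV
      obtain ⟨Z, hZ, rfl⟩ := mem_image.mp hW'
      rw [sdiff_inter_sdiff_eq_sdiff_union, sdiff_inter_sdiff_eq_sdiff_union] at heq
      have hw : Y \ X ⊆ Z := sdiff_subset_of_sdiff_union_eq S (h₂S Y hY) heq
      refine Or.inl (Or.inl (Or.inr ?_))
      show (S \ X) \ (S \ Y) ∈ _
      rw [sdiff_sdiff_sdiff_eq_sdiff S (h₂S Y hY)]
      exact mem_image.mpr ⟨(X, Y), mem_filter.mpr ⟨mem_product.mpr ⟨hX, hY⟩, Z, hZ, hw⟩, rfl⟩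
    · -- collapse of a `Q`-member: (S \ Y) \ (S \ Z) = Z \ Y, witnessed by `X ⊇ Z \ Y`
      obtain ⟨⟨V, W', U⟩, hp, rfl⟩ := mem_image.mp hT
      simp only [mem_filter, mem_product] at hp
      obtain ⟨⟨hV, hW', hU⟩, heq⟩ := hp
      obtain ⟨Y, hY, rfl⟩ := mem_image.mp hV
      obtain ⟨Z, hZ, rfl⟩ := mem_image.mp hW'
      obtain ⟨X, hX, rfl⟩ := mem_image.mp hU
      rw [sdiff_inter_sdiff_eq_sdiff_union, sdiff_inter_sdiff_eq_sdiff_union] at heq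
      have hw : Z \ Y ⊆ X := sdiff_subset_of_sdiff_union_eq S (h₃S Z hZ) heq
      refine Or.inl (Or.inr (Or.inr ?_))
      show (S \ Y) \ (S \ Z) ∈ _
      rw [sdiff_sdiff_sdiff_eq_sdiff S (h₃S Z hZ)]
      exact mem_image.mpr ⟨(Y, Z), mem_filter.mpr ⟨mem_product.mpr ⟨hY, hZ⟩, X, hX, hw⟩, rfl⟩
    · -- collapse of an `R`-member: (S \ Z) \ (S \ X) = X \ Z, witnessed by `Y ⊇ X \ Z`
      obtain ⟨⟨W', U, V⟩, hp, rfl⟩ := mem_image.mp hT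
      simp only [mem_filter, mem_product] at hp
      obtain ⟨⟨hW', hU, hV⟩, heq⟩ := hp
      obtain ⟨Z, hZ, rfl⟩ := mem_image.mp hW'
      obtain ⟨X, hX, rfl⟩ := mem_image.mp hU
      obtain ⟨Y, hY, rfl⟩ := mem_image.mp hV
      rw [sdiff_inter_sdiff_eq_sdiff_union, sdiff_inter_sdiff_eq_sdiff_union] at heq
      have hw : X \ Z ⊆ Y := sdiff_subset_of_sdiff_union_eq S (h₁S X hX) heq
      refine Or.inr (Or.inr ?_)
      show (S \ Z) \ (S \ X) ∈ _
      rw [sdiff_sdiff_sdiff_eq_sdiff S (h₁S X hX)]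
      exact mem_image.mpr ⟨(Z, X), mem_filter.mpr ⟨mem_product.mpr ⟨hZ, hX⟩, Y, hY, hw⟩, rfl⟩
  refine card_le_card_goods_above_cyclic S hf D₁ D₂ D₃ hij hjl hil h₁S h₁i h₁j h₂S h₂j h₂l
    h₃S h₃l h₃i ?_
  calc #D₁ + #D₂ + #D₃ = #P + #Q + #R := by rw [hcP, hcQ, hcR]
    _ ≤ _ := hPQR
    _ ≤ _ := card_le_card hKsub

end OrientedAntipodalHall

end Summit.CriticalPhenomena.PercolationContinuityZ3.Theorems
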